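import Mathlib
import HarnessLib
import Literature.NumberTheory.GaloisRepresentations.GaloisRep
import Literature.NumberTheory.GaloisRepresentations.FramedRepTwist

/-!
# Finite image is preserved by twisting (crux stmt-Langlands-15111, line Sketch, stub
`stub_finite_range_twist`) — helper file (`--supports`), odd-descent-up-to-twist sector (c15)

For a framed Galois representation `ρ : Γ_K →ₜ* GL_n(A)` and a continuous character
`χ : Γ_K →ₜ* Aˣ`, both of finite image, the twist `ρ ⊗ χ : g ↦ χ(g) · ρ(g)`
(`Literature.NumberTheory.GaloisRepresentations.FramedRep.twist`) has finite image: its range is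
contained in the image of the finite set `range χ × range ρ` under `(a, M) ↦ (a · 1) * M`.

* `stub_finite_range_twist` — `Finite (range ρ) → Finite (range χ) → Finite (range (ρ ⊗ χ))`.

Pure set theory (`Set.Finite.prod`, `Set.Finite.image`, `Set.Finite.subset`) plus the unfolding
lemma `FramedRep.twist_apply`.  No definitions.
-/

noncomputable section

open scoped MatrixGroups
open Literature.NumberTheory.GaloisRepresentations

-- `Summit.Langlands.Langlands.…`: summit = sub-problem name (D-0017 nested layout), not a typo.
set_option linter.dupNamespace false

namespace Summit.Langlands.Langlands.Theorems.ArtinWeightRealisationLevel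

/-- **Twisting preserves finite image.**  If `ρ : Γ_K → GL_n(A)` and `χ : Γ_K → Aˣ` have finite
image, so does `ρ ⊗ χ`: `range (ρ ⊗ χ) ⊆ (fun (a, M) ↦ (a · 1) * M) '' (range χ ×ˢ range ρ)`, a
finite set.  (Header = the signature registered on the crux item, verbatim.) [folklore] -/
theorem stub_finite_range_twist : ∀ (K : Type) [Field K] (A : Type) [CommRing A] [TopologicalSpace A] [IsTopologicalRing A] (n : ℕ) (ρ : Literature.NumberTheory.GaloisRepresentations.FramedGaloisRep K A n) (χ : Field.absoluteGaloisGroup K →ₜ* Aˣ), Finite ρ.toMonoidHom.range → Finite χ.toMonoidHom.range → Finite (Literature.NumberTheory.GaloisRepresentations.FramedRep.twist ρ χ).toMonoidHom.range := by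
  intro K _ A _ _ _ n ρ χ hρ hχ
  -- pass from `Finite ↥(f.toMonoidHom.range)` to `(Set.range f).Finite`
  have eρ : (ρ.toMonoidHom.range : Set (GL (Fin n) A)) = Set.range ρ := by
    rw [MonoidHom.coe_range]; rfl
  have eχ : (χ.toMonoidHom.range : Set Aˣ) = Set.range χ := by
    rw [MonoidHom.coe_range]; rfl
  have eτ : ((FramedRep.twist ρ χ).toMonoidHom.range : Set (GL (Fin n) A)) =
      Set.range (FramedRep.twist ρ χ) := by
    rw [MonoidHom.coe_range]; rfl
  have hρ' : (Set.range ρ).Finite := by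
    rw [← eρ]; exact Set.toFinite _
  have hχ' : (Set.range χ).Finite := by
    rw [← eχ]; exact Set.toFinite _
  -- the range of the twist sits inside the image of `range χ × range ρ` under `(a, M) ↦ a • M`
  have hsub : Set.range (FramedRep.twist ρ χ) ⊆
      (fun q : Aˣ × GL (Fin n) A => FramedRep.scalar A n q.1 * q.2) ''
        (Set.range χ ×ˢ Set.range ρ) := by
    rintro _ ⟨g, rfl⟩
    exact ⟨(χ g, ρ g), ⟨⟨g, rfl⟩, ⟨g, rfl⟩⟩, rfl⟩
  have hfin : (Set.range (FramedRep.twist ρ χ)).Finite :=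
    ((hχ'.prod hρ').image _).subset hsub
  exact Set.finite_coe_iff.mpr (eτ ▸ hfin)

end Summit.Langlands.Langlands.Theorems.ArtinWeightRealisationLevel

end
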